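import Mathlib
import Summits.Ventures.PercRepro2.Independence
import Summits.Ventures.PercRepro2.Harris
import Summits.Ventures.PercRepro2.HCov
import Summits.Ventures.PercRepro2.HCovSwap
import Summits.Ventures.PercRepro2.CutVertexPaths
import Summits.Ventures.PercRepro2.CutOneFarConn
import Summits.Ventures.PercRepro2.CutTwoFarConn
import Summits.Ventures.PercRepro2.CutTwoFarLaw
import Summits.Ventures.PercRepro2.CutTwoFar
import Summits.Ventures.PercRepro2.CutTwoFarHarris
import Summits.Ventures.PercRepro2.CutTwoFarRootsLaw
import Summits.Ventures.PercRepro2.CutTwoFarRightPat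
import Summits.Ventures.PercRepro2.CutTwoFarClasses
import Summits.Ventures.PercRepro2.CutTwoFarClasses2
import Summits.Ventures.PercRepro2.CutTwoFarA13Conn
import Summits.Ventures.PercRepro2.CutTwoFarA13Masses
import Summits.Ventures.PercRepro2.CutTwoFarA13Atoms
import Summits.Ventures.PercRepro2.CutTwoFarA13
import Summits.Ventures.PercRepro2.CutTwoFarA13Blocks

/-!
# Two marks behind a cut vertex: ALL TEN CLASSES (blind cell PercRepro2, typer-1 g51)

(HCOV) on the two `a₃`-root classes of S3.5 — a root and `a₃` behind the cut vertex (`{a₁, a₃}`,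
`{a₂, a₃}`; T5, `HCov_a13Far`), the two far marks on the left of `CutVertex ends side L v Rt` or on
its right (`CutVertex.symm`), the root `a₁` or the root `a₂` (`CovForm.Gc_swap`) — and, with
`CutTwoFarClasses.lean` (T1–T4) and `CutTwoFarClasses2.lean` (T6, T7), **`HCov_cut_twoLeft`**:
(HCOV) holds whenever two of the five marks lie on one side of a cut vertex (or at it) and the
other three on the other side (or at it) — ALL TEN two-far-mark cut-vertex classes of
MINE2-CUTVERTEX §13 / S3.5, every weighted part, every weight vector, in the kernel.
Own work; standard axioms.
-/

namespace Summit.Ventures.PercRepro2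

open CovForm CutVertexM9

namespace CutTwoFar

section Classes3

variable {V : Type*} {E : Type*} [Fintype E] [DecidableEq E] [Fintype V] [DecidableEq V]
  {R : Type*} [Field R] [LinearOrder R] [IsStrictOrderedRing R]
variable {ends : E → Sym2 V} {side : E → Bool} {L : Set V} {v : V} {Rt : Set V}
  (h : CutVertex ends side L v Rt) {o a₁ a₂ a₃ b : V} {p : E → R} (hp : IsProbVec p)
include h hp

/-- **`a₁` and `a₃` behind the cut vertex** (T5). -/
theorem HCov_cut_a1a3 (h₁ : a₁ ∈ L ∨ a₁ = v) (h3 : a₃ ∈ L ∨ a₃ = v) (h₂ : a₂ ∈ Rt ∨ a₂ = v)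
    (ho : o ∈ Rt ∨ o = v) (hb : b ∈ Rt ∨ b = v) : HCov p ends o a₁ a₂ a₃ b :=
  HCov_a13Far h p h₁ h3 h₂ ho hb hp

/-- **`a₁` and `a₃` behind the cut vertex**, the sides swapped (T5). -/
theorem HCov_cut_a1a3' (h₁ : a₁ ∈ Rt ∨ a₁ = v) (h3 : a₃ ∈ Rt ∨ a₃ = v) (h₂ : a₂ ∈ L ∨ a₂ = v)
    (ho : o ∈ L ∨ o = v) (hb : b ∈ L ∨ b = v) : HCov p ends o a₁ a₂ a₃ b :=
  HCov_a13Far h.symm p h₁ h3 h₂ ho hb hp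

/-- **`a₂` and `a₃` behind the cut vertex** (T5, the root symmetry). -/
theorem HCov_cut_a2a3 (h₂ : a₂ ∈ L ∨ a₂ = v) (h3 : a₃ ∈ L ∨ a₃ = v) (h₁ : a₁ ∈ Rt ∨ a₁ = v)
    (ho : o ∈ Rt ∨ o = v) (hb : b ∈ Rt ∨ b = v) : HCov p ends o a₁ a₂ a₃ b := by
  unfold HCov
  rw [← Gc_swap]
  exact HCov_a13Far h p h₂ h3 h₁ ho hb hp

/-- **`a₂` and `a₃` behind the cut vertex**, the sides swapped (T5). -/
theorem HCov_cut_a2a3' (h₂ : a₂ ∈ Rt ∨ a₂ = v) (h3 : a₃ ∈ Rt ∨ a₃ = v) (h₁ : a₁ ∈ L ∨ a₁ = v)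
    (ho : o ∈ L ∨ o = v) (hb : b ∈ L ∨ b = v) : HCov p ends o a₁ a₂ a₃ b := by
  unfold HCov
  rw [← Gc_swap]
  exact HCov_a13Far h.symm p h₂ h3 h₁ ho hb hp

/-- **THE TEN TWO-FAR-MARK CLASSES** (S3.5 (C5), MINE2-CUTVERTEX §13): if two of the five marks lie
on the left of the cut vertex `v` (or at it) and the other three on its right (or at it), then
(HCOV) holds — for each of the ten role pairs `{a₁,a₂}`, `{a₁,a₃}`, `{a₂,a₃}`, `{a₁,o}`, `{a₂,o}`,
`{a₁,b}`, `{a₂,b}`, `{a₃,o}`, `{a₃,b}`, `{o,b}`. -/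
theorem HCov_cut_twoLeft
    (hpair :
      ((a₁ ∈ L ∨ a₁ = v) ∧ (a₂ ∈ L ∨ a₂ = v) ∧ (o ∈ Rt ∨ o = v) ∧ (a₃ ∈ Rt ∨ a₃ = v) ∧ (b ∈ Rt ∨ b = v)) ∨
      ((a₁ ∈ L ∨ a₁ = v) ∧ (a₃ ∈ L ∨ a₃ = v) ∧ (o ∈ Rt ∨ o = v) ∧ (a₂ ∈ Rt ∨ a₂ = v) ∧ (b ∈ Rt ∨ b = v)) ∨
      ((a₂ ∈ L ∨ a₂ = v) ∧ (a₃ ∈ L ∨ a₃ = v) ∧ (o ∈ Rt ∨ o = v) ∧ (a₁ ∈ Rt ∨ a₁ = v) ∧ (b ∈ Rt ∨ b = v)) ∨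
      ((a₁ ∈ L ∨ a₁ = v) ∧ (o ∈ L ∨ o = v) ∧ (a₂ ∈ Rt ∨ a₂ = v) ∧ (a₃ ∈ Rt ∨ a₃ = v) ∧ (b ∈ Rt ∨ b = v)) ∨
      ((a₂ ∈ L ∨ a₂ = v) ∧ (o ∈ L ∨ o = v) ∧ (a₁ ∈ Rt ∨ a₁ = v) ∧ (a₃ ∈ Rt ∨ a₃ = v) ∧ (b ∈ Rt ∨ b = v)) ∨
      ((a₁ ∈ L ∨ a₁ = v) ∧ (b ∈ L ∨ b = v) ∧ (a₂ ∈ Rt ∨ a₂ = v) ∧ (a₃ ∈ Rt ∨ a₃ = v) ∧ (o ∈ Rt ∨ o = v)) ∨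
      ((a₂ ∈ L ∨ a₂ = v) ∧ (b ∈ L ∨ b = v) ∧ (a₁ ∈ Rt ∨ a₁ = v) ∧ (a₃ ∈ Rt ∨ a₃ = v) ∧ (o ∈ Rt ∨ o = v)) ∨
      ((o ∈ L ∨ o = v) ∧ (a₃ ∈ L ∨ a₃ = v) ∧ (a₁ ∈ Rt ∨ a₁ = v) ∧ (a₂ ∈ Rt ∨ a₂ = v) ∧ (b ∈ Rt ∨ b = v)) ∨
      ((a₃ ∈ L ∨ a₃ = v) ∧ (b ∈ L ∨ b = v) ∧ (a₁ ∈ Rt ∨ a₁ = v) ∧ (a₂ ∈ Rt ∨ a₂ = v) ∧ (o ∈ Rt ∨ o = v)) ∨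
      ((o ∈ L ∨ o = v) ∧ (b ∈ L ∨ b = v) ∧ (a₁ ∈ Rt ∨ a₁ = v) ∧ (a₂ ∈ Rt ∨ a₂ = v) ∧ (a₃ ∈ Rt ∨ a₃ = v))) :
    HCov p ends o a₁ a₂ a₃ b := by
  rcases hpair with ⟨h₁, h₂, ho, h3, hb⟩ | ⟨h₁, h3, ho, h₂, hb⟩ | ⟨h₂, h3, ho, h₁, hb⟩ |
    ⟨h₁, ho, h₂, h3, hb⟩ | ⟨h₂, ho, h₁, h3, hb⟩ | ⟨h₁, hb, h₂, h3, ho⟩ | ⟨h₂, hb, h₁, h3, ho⟩ |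
    ⟨ho, h3, h₁, h₂, hb⟩ | ⟨h3, hb, h₁, h₂, ho⟩ | ⟨ho, hb, h₁, h₂, h3⟩
  · exact HCov_cut_roots h hp h₁ h₂ ho h3 hb
  · exact HCov_cut_a1a3 h hp h₁ h3 h₂ ho hb
  · exact HCov_cut_a2a3 h hp h₂ h3 h₁ ho hb
  · exact HCov_cut_a1o h hp h₁ ho h₂ h3 hb
  · exact HCov_cut_a2o h hp h₂ ho h₁ h3 hb
  · exact HCov_cut_a1b h hp h₁ hb h₂ h3 ho
  · exact HCov_cut_a2b h hp h₂ hb h₁ h3 ho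
  · exact HCov_cut_oa3 h hp ho h3 h₁ h₂ hb
  · exact HCov_cut_a3b h hp h3 hb h₁ h₂ ho
  · exact HCov_cut_ob h hp ho hb h₁ h₂ h3

/-- **THE TEN TWO-FAR-MARK CLASSES**, the sides swapped: two marks on the right (or at `v`), three
on the left (or at `v`). -/
theorem HCov_cut_twoRight
    (hpair :
      ((a₁ ∈ Rt ∨ a₁ = v) ∧ (a₂ ∈ Rt ∨ a₂ = v) ∧ (o ∈ L ∨ o = v) ∧ (a₃ ∈ L ∨ a₃ = v) ∧ (b ∈ L ∨ b = v)) ∨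
      ((a₁ ∈ Rt ∨ a₁ = v) ∧ (a₃ ∈ Rt ∨ a₃ = v) ∧ (o ∈ L ∨ o = v) ∧ (a₂ ∈ L ∨ a₂ = v) ∧ (b ∈ L ∨ b = v)) ∨
      ((a₂ ∈ Rt ∨ a₂ = v) ∧ (a₃ ∈ Rt ∨ a₃ = v) ∧ (o ∈ L ∨ o = v) ∧ (a₁ ∈ L ∨ a₁ = v) ∧ (b ∈ L ∨ b = v)) ∨
      ((a₁ ∈ Rt ∨ a₁ = v) ∧ (o ∈ Rt ∨ o = v) ∧ (a₂ ∈ L ∨ a₂ = v) ∧ (a₃ ∈ L ∨ a₃ = v) ∧ (b ∈ L ∨ b = v)) ∨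
      ((a₂ ∈ Rt ∨ a₂ = v) ∧ (o ∈ Rt ∨ o = v) ∧ (a₁ ∈ L ∨ a₁ = v) ∧ (a₃ ∈ L ∨ a₃ = v) ∧ (b ∈ L ∨ b = v)) ∨
      ((a₁ ∈ Rt ∨ a₁ = v) ∧ (b ∈ Rt ∨ b = v) ∧ (a₂ ∈ L ∨ a₂ = v) ∧ (a₃ ∈ L ∨ a₃ = v) ∧ (o ∈ L ∨ o = v)) ∨
      ((a₂ ∈ Rt ∨ a₂ = v) ∧ (b ∈ Rt ∨ b = v) ∧ (a₁ ∈ L ∨ a₁ = v) ∧ (a₃ ∈ L ∨ a₃ = v) ∧ (o ∈ L ∨ o = v)) ∨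
      ((o ∈ Rt ∨ o = v) ∧ (a₃ ∈ Rt ∨ a₃ = v) ∧ (a₁ ∈ L ∨ a₁ = v) ∧ (a₂ ∈ L ∨ a₂ = v) ∧ (b ∈ L ∨ b = v)) ∨
      ((a₃ ∈ Rt ∨ a₃ = v) ∧ (b ∈ Rt ∨ b = v) ∧ (a₁ ∈ L ∨ a₁ = v) ∧ (a₂ ∈ L ∨ a₂ = v) ∧ (o ∈ L ∨ o = v)) ∨
      ((o ∈ Rt ∨ o = v) ∧ (b ∈ Rt ∨ b = v) ∧ (a₁ ∈ L ∨ a₁ = v) ∧ (a₂ ∈ L ∨ a₂ = v) ∧ (a₃ ∈ L ∨ a₃ = v))) :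
    HCov p ends o a₁ a₂ a₃ b :=
  HCov_cut_twoLeft h.symm hp hpair

end Classes3

end CutTwoFar

end Summit.Ventures.PercRepro2
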